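import Summits.QuantumFields.YangMills.Theorems.SmallCircleAnchorAnchorGapGaussianSmoothDeriv

/-!
# Crux `AnchorGap` (stmt-QuantumFields-11141), line `registered` — stub SMOOTH

The registered generic stub `stub_gaussianIntegralSmooth` of `Cruxes/AnchorGap/Lines/birth.lean`
(Gaussian integrals of polynomially bounded observables are `C^∞` in the precision on the positive
definite cone), PROVED from part 1 (`SmallCircleAnchorAnchorGapGaussianSmoothDeriv.lean`).
[folklore]; no definition, no named fact.

* §4 `GaussSmooth.integrable_fderiv_integrand`, `GaussSmooth.fderiv_gaussInt_apply` — the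
  directional derivative in direction `Y` is the Gaussian integral of `H_Y(φ) = (−½ φᵀYφ) H(φ)`;
  `GaussSmooth.quadMul_mem_class` — `H_Y` is again measurable of polynomial growth (degree `m+1`);
  `GaussSmooth.contDiffOn_gaussInt_nat` — induction on the order on the OPEN set of coercive matrices
  (`contDiffOn_succ_iff_fderiv_apply`, `fderivWithin_of_isOpen`);
* `stub_gaussianIntegralSmooth` — `contDiffOn_infty` and restriction to the positive definite cone
  (`GaussSmooth.posDef_subset_coercive`).
-/

set_option autoImplicit false

noncomputable section

namespace Summit.QuantumFields.YangMills.Theorems.AnchorGap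

namespace GaussSmooth

open MeasureTheory Finset Matrix Filter Metric
open scoped Topology

variable {ι : Type} [Fintype ι]

/-! ### §4 The derivative is again a Gaussian integral of the class; induction on the order -/

/-- The derivative integrand at a coercive `P₀` is integrable (same domination). [folklore] -/
theorem integrable_fderiv_integrand [DecidableEq ι] {c : ℝ} (hc : 0 < c) {P₀ : ι → ι → ℝ}
    (hP₀ : ∀ φ : ι → ℝ, c * ∑ i, φ i ^ 2 ≤ φ ⬝ᵥ (Matrix.of P₀ *ᵥ φ)) {m : ℕ} {K : ℝ}
    {H : (ι → ℝ) → ℝ} (hHm : Measurable H) (hHb : ∀ φ : ι → ℝ, |H φ| ≤ K * (1 + ∑ i, φ i ^ 2) ^ m)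
    {Q : (ι → ℝ) → ((ι → ι → ℝ) →L[ℝ] ℝ)}
    (hQn : ∀ φ, ‖Q φ‖ ≤ ∑ a, ∑ b, |φ a| * |φ b|) (hQc : Continuous Q) :
    Integrable (fun φ : ι → ℝ =>
      (H φ * Real.exp (-(φ ⬝ᵥ (Matrix.of P₀ *ᵥ φ)) / 2) * (-(1 / 2) : ℝ)) • Q φ) := by
  have hK : 0 ≤ K := nonneg_of_polyBound hHb
  have hqc : Continuous fun φ : ι → ℝ => φ ⬝ᵥ (Matrix.of P₀ *ᵥ φ) :=
    continuous_id.dotProduct (Continuous.matrix_mulVec continuous_const continuous_id)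
  have hFm : Measurable fun φ : ι → ℝ => H φ * Real.exp (-(φ ⬝ᵥ (Matrix.of P₀ *ᵥ φ)) / 2) :=
    hHm.mul (hqc.neg.div_const _).rexp.measurable
  set G : (ι → ℝ) → ℝ := fun φ => |H φ| * ∑ a, ∑ b, |φ a| * |φ b| with hG
  have hGm : Measurable G :=
    hHm.abs.mul (Finset.measurable_sum _ fun a _ =>
      Finset.measurable_sum _ fun b _ => ((measurable_pi_apply a).abs.mul (measurable_pi_apply b).abs))
  have hGb : ∀ φ : ι → ℝ, |G φ| ≤ K * (Fintype.card ι : ℝ) ^ 2 * (1 + ∑ i, φ i ^ 2) ^ (m + 1) := by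
    intro φ
    have h1 := hHb φ
    have h2 := sum_abs_mul_abs_le φ
    have hss : 0 ≤ ∑ a, ∑ b, |φ a| * |φ b| :=
      Finset.sum_nonneg fun a _ => Finset.sum_nonneg fun b _ => by positivity
    rw [hG, abs_mul, abs_abs, abs_of_nonneg hss, pow_succ]
    calc |H φ| * ∑ a, ∑ b, |φ a| * |φ b|
        ≤ (K * (1 + ∑ i, φ i ^ 2) ^ m) * ((Fintype.card ι : ℝ) ^ 2 * (1 + ∑ i, φ i ^ 2)) :=
          mul_le_mul h1 h2 hss (by positivity)
      _ = K * (Fintype.card ι : ℝ) ^ 2 * ((1 + ∑ i, φ i ^ 2) ^ m * (1 + ∑ i, φ i ^ 2)) := by ring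
  have hint : Integrable (fun φ : ι → ℝ => G φ * Real.exp (-(φ ⬝ᵥ (Matrix.of P₀ *ᵥ φ)) / 2)) :=
    integrable_of_coercive hc hP₀ hGm hGb
  refine hint.mono' ((hFm.mul_const _).aestronglyMeasurable.smul hQc.aestronglyMeasurable)
    (Filter.Eventually.of_forall fun φ => ?_)
  rw [norm_smul, Real.norm_eq_abs, abs_mul, abs_mul, Real.abs_exp,
    abs_of_nonpos (by norm_num : (-(1 / 2) : ℝ) ≤ 0), neg_neg, hG]
  calc |H φ| * Real.exp (-(φ ⬝ᵥ (Matrix.of P₀ *ᵥ φ)) / 2) * (1 / 2) * ‖Q φ‖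
      ≤ |H φ| * Real.exp (-(φ ⬝ᵥ (Matrix.of P₀ *ᵥ φ)) / 2) * 1 * ∑ a, ∑ b, |φ a| * |φ b| :=
        mul_le_mul (mul_le_mul_of_nonneg_left (by norm_num) (by positivity)) (hQn φ)
          (norm_nonneg _) (by positivity)
    _ = |H φ| * (∑ a, ∑ b, |φ a| * |φ b|) * Real.exp (-(φ ⬝ᵥ (Matrix.of P₀ *ᵥ φ)) / 2) := by ring

/-- **The directional derivatives are Gaussian integrals of the same class.** At a coercive `P₀`,
`(fderiv I_H)(P₀) Y = I_{H_Y}(P₀)` with `H_Y(φ) = (−½ φᵀYφ) H(φ)`. [folklore] -/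
theorem fderiv_gaussInt_apply [DecidableEq ι] {c : ℝ} (hc : 0 < c) {P₀ : ι → ι → ℝ}
    (hP₀ : ∀ φ : ι → ℝ, c * ∑ i, φ i ^ 2 ≤ φ ⬝ᵥ (Matrix.of P₀ *ᵥ φ)) {m : ℕ} {K : ℝ}
    {H : (ι → ℝ) → ℝ} (hHm : Measurable H) (hHb : ∀ φ : ι → ℝ, |H φ| ≤ K * (1 + ∑ i, φ i ^ 2) ^ m)
    {Q : (ι → ℝ) → ((ι → ι → ℝ) →L[ℝ] ℝ)} (hQ : ∀ φ P, Q φ P = φ ⬝ᵥ (Matrix.of P *ᵥ φ))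
    (hQn : ∀ φ, ‖Q φ‖ ≤ ∑ a, ∑ b, |φ a| * |φ b|) (hQc : Continuous Q) (Y : ι → ι → ℝ) :
    fderiv ℝ (fun P : ι → ι → ℝ => ∫ φ : ι → ℝ, H φ * Real.exp (-(φ ⬝ᵥ (Matrix.of P *ᵥ φ)) / 2)) P₀ Y
      = ∫ φ : ι → ℝ, (-(1 / 2) * (φ ⬝ᵥ (Matrix.of Y *ᵥ φ)) * H φ)
          * Real.exp (-(φ ⬝ᵥ (Matrix.of P₀ *ᵥ φ)) / 2) := by
  rw [(hasFDerivAt_gaussInt hc hP₀ hHm hHb hQ hQn hQc).fderiv,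
    ContinuousLinearMap.integral_apply (integrable_fderiv_integrand hc hP₀ hHm hHb hQn hQc) Y]
  refine integral_congr_ae (Filter.Eventually.of_forall fun φ => ?_)
  simp only [FunLike.coe_smul, Pi.smul_apply, hQ, smul_eq_mul]
  ring

/-- The class is stable under multiplication by a quadratic form: `H_Y` is measurable with
`|H_Y| ≤ (½ Σ|Y_{ab}| · K) (1 + Σφᵢ²)^{m+1}`. [folklore] -/
theorem quadMul_mem_class {m : ℕ} {K : ℝ} {H : (ι → ℝ) → ℝ} (hHm : Measurable H)
    (hHb : ∀ φ : ι → ℝ, |H φ| ≤ K * (1 + ∑ i, φ i ^ 2) ^ m) (Y : ι → ι → ℝ) :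
    Measurable (fun φ : ι → ℝ => -(1 / 2) * (φ ⬝ᵥ (Matrix.of Y *ᵥ φ)) * H φ) ∧
      ∀ φ : ι → ℝ, |-(1 / 2) * (φ ⬝ᵥ (Matrix.of Y *ᵥ φ)) * H φ|
        ≤ (1 / 2 * (∑ p, ∑ q, |Y p q|) * K) * (1 + ∑ i, φ i ^ 2) ^ (m + 1) := by
  have hqc : Continuous fun φ : ι → ℝ => φ ⬝ᵥ (Matrix.of Y *ᵥ φ) :=
    continuous_id.dotProduct (Continuous.matrix_mulVec continuous_const continuous_id)
  refine ⟨(hqc.measurable.const_mul _).mul hHm, fun φ => ?_⟩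
  have h1 := abs_quadForm_le_sum_entries Y φ
  have h2 := hHb φ
  have hS : ∑ i, φ i ^ 2 ≤ 1 + ∑ i, φ i ^ 2 := by linarith
  have hs0 : 0 ≤ ∑ i, φ i ^ 2 := Finset.sum_nonneg fun i _ => sq_nonneg _
  have hY0 : 0 ≤ ∑ p, ∑ q, |Y p q| := Finset.sum_nonneg fun p _ => Finset.sum_nonneg fun q _ => abs_nonneg _
  rw [abs_mul, abs_mul, abs_neg, abs_of_pos (by norm_num : (0 : ℝ) < 1 / 2), pow_succ]
  calc 1 / 2 * |φ ⬝ᵥ (Matrix.of Y *ᵥ φ)| * |H φ|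
      ≤ 1 / 2 * ((∑ p, ∑ q, |Y p q|) * (1 + ∑ i, φ i ^ 2)) * (K * (1 + ∑ i, φ i ^ 2) ^ m) := by
        refine mul_le_mul (mul_le_mul_of_nonneg_left (h1.trans
          (mul_le_mul_of_nonneg_left hS hY0)) (by norm_num)) h2 (abs_nonneg _) (by positivity)
    _ = 1 / 2 * (∑ p, ∑ q, |Y p q|) * K * ((1 + ∑ i, φ i ^ 2) ^ m * (1 + ∑ i, φ i ^ 2)) := by ring

/-- **Induction on the order**: on the open set of coercive matrices, every Gaussian integral of the
class is `C^n` for every `n : ℕ` — differentiable by §3, and its directional derivatives are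
Gaussian integrals of the class (`contDiffOn_succ_iff_fderiv_apply`). [folklore] -/
theorem contDiffOn_gaussInt_nat [DecidableEq ι] (n : ℕ) :
    ∀ (m : ℕ) (K : ℝ) (H : (ι → ℝ) → ℝ), Measurable H → (∀ φ : ι → ℝ, |H φ| ≤ K * (1 + ∑ i, φ i ^ 2) ^ m) →
      ContDiffOn ℝ n (fun P : ι → ι → ℝ => ∫ φ : ι → ℝ, H φ * Real.exp (-(φ ⬝ᵥ (Matrix.of P *ᵥ φ)) / 2))
        {P : ι → ι → ℝ | ∃ c : ℝ, 0 < c ∧ ∀ φ : ι → ℝ, c * ∑ i, φ i ^ 2 ≤ φ ⬝ᵥ (Matrix.of P *ᵥ φ)} := by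
  obtain ⟨Q, hQ, hQn, hQc⟩ := exists_quadCLM ι
  induction n with
  | zero =>
    intro m K H hHm hHb
    rw [Nat.cast_zero, contDiffOn_zero]
    intro P hP
    obtain ⟨c, hc, hcoer⟩ := hP
    exact (hasFDerivAt_gaussInt hc hcoer hHm hHb hQ hQn hQc).continuousAt.continuousWithinAt
  | succ n ih =>
    intro m K H hHm hHb
    rw [Nat.cast_succ, contDiffOn_succ_iff_fderiv_apply isOpen_coercive.uniqueDiffOn]
    refine ⟨fun P hP => ?_, by simp, fun Y => ?_⟩
    · obtain ⟨c, hc, hcoer⟩ := hP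
      exact (hasFDerivAt_gaussInt hc hcoer hHm hHb hQ hQn hQc).differentiableAt.differentiableWithinAt
    · obtain ⟨hYm, hYb⟩ := quadMul_mem_class hHm hHb Y
      refine (ih (m + 1) _ _ hYm hYb).congr fun P hP => ?_
      rw [fderivWithin_of_isOpen isOpen_coercive hP]
      obtain ⟨c, hc, hcoer⟩ := hP
      exact fderiv_gaussInt_apply hc hcoer hHm hHb hQ hQn hQc Y

end GaussSmooth


open scoped Matrix

open MeasureTheory in
/-- **Stub SMOOTH (GENERIC; M/L — Gaussian integrals of polynomially bounded observables are smooth in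
the precision).** For a measurable `H` with `|H φ| ≤ K(1+|φ|²)^m`, the un-normalised Gaussian integral
`P ↦ ∫ H(φ) e^{−½ φᵀPφ} dφ` is `C^∞` on the open cone of positive definite `P` (coordinates
`P : ι → ι → ℝ`, matrix `Matrix.of P`): each derivative in `P_{ab}` brings down `−½ φ_a φ_b`, again a
polynomially bounded measurable observable, and differentiation under the integral sign is dominated
locally uniformly on the cone (`posDef_coercive`); induct on the order.  Proof: on the OPEN set of
coercive matrices (`GaussSmooth.isOpen_coercive`, which contains the positive definite ones by
`posDef_coercive`) the integral has a Fréchet derivative in the matrix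
(`GaussSmooth.hasFDerivAt_gaussInt`, by `hasFDerivAt_integral_of_dominated_of_fderiv_le` with the
domination `integrable_polyGrowth_mul_gaussian` of `…StubDebyeScreening18` on a sup-norm ball where
`φᵀPφ ≥ (c/2)Σφᵢ²`), whose directional derivatives are Gaussian integrals of the same class
(`GaussSmooth.fderiv_gaussInt_apply`, `GaussSmooth.quadMul_mem_class`); induction on `n` via
`contDiffOn_succ_iff_fderiv_apply`, then `contDiffOn_infty` and restriction to the cone. [folklore] -/
theorem stub_gaussianIntegralSmooth :
    ∀ (ι : Type) [Fintype ι] [DecidableEq ι] (H : (ι → ℝ) → ℝ) (K : ℝ) (m : ℕ), Measurable H → (∀ φ : ι → ℝ, |H φ| ≤ K * (1 + ∑ i, φ i ^ 2) ^ m) → ContDiffOn ℝ (⊤ : ℕ∞) (fun P : ι → ι → ℝ => ∫ φ : ι → ℝ, H φ * Real.exp (-(φ ⬝ᵥ (Matrix.of P *ᵥ φ)) / 2)) {P : ι → ι → ℝ | (Matrix.of P).PosDef} := by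
  intro ι _ _ H K m hHm hHb
  refine ContDiffOn.mono ?_ GaussSmooth.posDef_subset_coercive
  rw [contDiffOn_infty]
  intro n
  exact GaussSmooth.contDiffOn_gaussInt_nat n m K H hHm hHb

end Summit.QuantumFields.YangMills.Theorems.AnchorGap
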